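import Summits.QuantumFields.YangMills.Theorems.FluctuationComparisonRegPrIntLS2BetaOrbitDistComparison
import Summits.QuantumFields.YangMills.Theorems.FluctuationComparisonRegPrIntLS2BetaResidualGauge
import HarnessLib

/-!
# S2β · GAP♯∘ — REBASE-U «THE BODY DOOR FOR A RESIDUAL RE-GAUGING OF THE FINE FIELD»: the stratum gap body at `(V, U₀, U)` ⟺ the body at `(V, U₀, r•U)`
# for every RESIDUAL `r` (datum `V` and minimiser `U₀` FIXED), with the fibre ∕ `histGood` membership companions

Cell `ym3-torus` (rung R3 = continuum `SU(2)` YM₃ on T³ at fixed lattice data — NOT d = 4, NOT infinite volume, NOT a mass gap, NOT Clay).  Width seat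
`ym3-torus-px16` (gen 24); crux `stmt-QuantumFields-20520` `FluctuationComparisonRegPrIntL`, LINE g18-1 S2β (registry `Lines/semiclassical_s2beta.lean`
untouched); organ GAP♯∘.  ARCHITECT px17 g23 (2026-09-01T00:41Z (1)) ∕ desk RULING №126 ∕ №702: the knit wants to evaluate the sup chain's towers at a
RE-GAUGED fine field `r•U` (the Thm-2 representative's residual half; the block-constant half `ǔ` is (RES-u), not here).  The GAP♯∘ body
`μ·L^{−2(K−J)}·⨅_{w residual} Σ_ℓ dist1(U ℓ·((w•U₀) ℓ)⁻¹)² ≤ A(U) − A_min(V)` is INVARIANT under `U ↦ r•U` for residual `r` with `V, U₀` fixed: the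
orbit infimum is re-indexed by `w ↦ r⁻¹·w` (residual transformations form a group, ✓`residual_mul`∕`residual_inv`) using
`d²(r•U, w•U₀) = d²(U, (r⁻¹w)•U₀)` (common-gauge invariance ✓`sum_dist1_sq_gaugeAct`), and `A(r•U) = A(U)` (✓`wilsonAction4_gaugeAct`).
THIS FILE (def-free): §1 `sum_dist1_sq_gaugeAct_left` (the re-indexing identity), §2 ★`iInf_orbitDistSq_gaugeAct_residual` (the orbit infimum is
unchanged), §3 ★★`body_gaugeAct_residual_iff` (the body text VERBATIM — ✓p838507's conclusion tail — at `r•U` ⟺ at `U`) and the USE form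
`body_of_body_gaugeAct_residual`; the membership companions are ALREADY on the tree and are re-exported by name only in the docstrings:
✓`gaugeAct_mem_fibre_iff_of_residual`, ✓`gaugeAct_mem_histGood_iff` (`…S2BetaResidualGauge`).
`--kind proof --supports stmt-QuantumFields-20520 --as helper`, count-neutral, DEFINITION-FREE (0 `def`, 0 `instance`, 0 `sorry`; default heartbeats).

HONEST.  Gauge-covariance plumbing over landed lemmas; the `ǔ` half (RES-u), (REG), «GAUGE-REP», hsupp, hD, hDBX are OPEN ∕ HYPOTHESES elsewhere; nothing
of Bałaban's analysis asserted ([Balaban1985Variational] p.278 «𝔘_k is gauge invariant», Thm 1 (8)–(10) p.279; [Balaban1987RG1] p.256 «these transformations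
form a group»); GAP♯∘ (`stub_uniformFibreGapOrbit`, 0∕5), the five REGISTERED stubs, S2β, crux 20520, 19936, 19200, `YM3TorusSU2` NOT proved; no summit
statement is proved by a helper; rung R3 = SU(2) YM₃ on T³ — NOT d = 4, NOT infinite volume, NOT a mass gap, NOT Clay; the Yang–Mills mass gap is NOT proved.
-/

set_option autoImplicit false

noncomputable section

namespace Summit.QuantumFields.YangMills.Theorems.FluctuationComparisonRegPrIntLS2BetaBodyRebaseResidual

open Finset
open Literature.MathematicalPhysics.QuantumFieldTheory.Balaban1983to89
open T4Continuum T3ContinuumYM3Torus T3UnitScaleTilt T3TiltDescent T3LevelShift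
open T3UnitLawDensityEML (ℰp)
open T3ConstrainedMinimiser (fibre)
open T3PrintedRegularMinimiser (minActionRegPr)
open Summit.QuantumFields.YangMills.Theorems.FluctuationComparisonRegPrIntLS2BetaResidualGauge
  (gaugeAct_mul_eq residual_one residual_mul residual_inv wilsonAction4_gaugeAct gaugeAct_mem_fibre_iff_of_residual gaugeAct_mem_histGood_iff)
open Summit.QuantumFields.YangMills.Theorems.FluctuationComparisonRegPrIntLS2BetaOrbitDistComparison
  (sum_dist1_sq_gaugeAct iInf_orbitDistSq_le_of_residual)

variable (F : T3Family) {J K : ℕ} (hJK : J ≤ K)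

/-! ## §1 Re-indexing the orbit: `d²(r•U, w•U₀) = d²(U, (r⁻¹w)•U₀)` -/

/-- `d²(r•U, w•U₀) = d²(U, (r⁻¹·w)•U₀)`: write `w = r·(r⁻¹w)` and cancel the common left gauge `r` (✓`sum_dist1_sq_gaugeAct`).
[cite: Balaban1985Averaging, (8) p.19] -/
theorem sum_dist1_sq_gaugeAct_left (r w : Site (F.P K) 0 → Matrix.specialUnitaryGroup (Fin 2) ℂ)
    (U U₀ : GaugeField (F.P K) 0 (Matrix.specialUnitaryGroup (Fin 2) ℂ)) :
    ∑ ℓ : PBond (F.P K) 0, dist1 ((GaugeField.gaugeAct r U) ℓ * ((GaugeField.gaugeAct w U₀) ℓ)⁻¹) ^ 2 =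
      ∑ ℓ : PBond (F.P K) 0, dist1 (U ℓ * ((GaugeField.gaugeAct (r⁻¹ * w) U₀) ℓ)⁻¹) ^ 2 := by
  have hw : GaugeField.gaugeAct w U₀ = GaugeField.gaugeAct r (GaugeField.gaugeAct (r⁻¹ * w) U₀) := by
    rw [← gaugeAct_mul_eq, ← mul_assoc, mul_inv_cancel, one_mul]
  rw [hw, sum_dist1_sq_gaugeAct]

/-! ## §2 The orbit infimum is unchanged under a residual re-gauging of the fine field -/

/-- ★ **`⨅_{w residual} d²(r•U, w•U₀) = ⨅_{w residual} d²(U, w•U₀)` for residual `r`** (both inequalities by testing the infimum at `r·w` ∕ `r⁻¹·w`,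
residual by ✓`residual_mul`∕✓`residual_inv`). [cite: Balaban1985Variational, Thm 1 (8)-(10) p.279; Balaban1987RG1, p.256] -/
theorem iInf_orbitDistSq_gaugeAct_residual {r : Site (F.P K) 0 → Matrix.specialUnitaryGroup (Fin 2) ℂ}
    (hr : ∀ U : GaugeField (F.P K) 0 (Matrix.specialUnitaryGroup (Fin 2) ℂ),
      descendTo F ℰp J K hJK (GaugeField.gaugeAct r U) = descendTo F ℰp J K hJK U)
    (U U₀ : GaugeField (F.P K) 0 (Matrix.specialUnitaryGroup (Fin 2) ℂ)) :
    (⨅ w : {w : GaugeTransf (F.P K) 0 (Matrix.specialUnitaryGroup (Fin 2) ℂ) | ∀ U : GaugeField (F.P K) 0 (Matrix.specialUnitaryGroup (Fin 2) ℂ),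
          descendTo F ℰp J K hJK (GaugeField.gaugeAct w U) = descendTo F ℰp J K hJK U}, ∑ ℓ : PBond (F.P K) 0,
        dist1 ((GaugeField.gaugeAct r U) ℓ * ((GaugeField.gaugeAct (w : GaugeTransf (F.P K) 0 (Matrix.specialUnitaryGroup (Fin 2) ℂ)) U₀) ℓ)⁻¹) ^ 2) =
      ⨅ w : {w : GaugeTransf (F.P K) 0 (Matrix.specialUnitaryGroup (Fin 2) ℂ) | ∀ U : GaugeField (F.P K) 0 (Matrix.specialUnitaryGroup (Fin 2) ℂ),
          descendTo F ℰp J K hJK (GaugeField.gaugeAct w U) = descendTo F ℰp J K hJK U}, ∑ ℓ : PBond (F.P K) 0,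
        dist1 (U ℓ * ((GaugeField.gaugeAct (w : GaugeTransf (F.P K) 0 (Matrix.specialUnitaryGroup (Fin 2) ℂ)) U₀) ℓ)⁻¹) ^ 2 := by
  haveI : Nonempty {w : GaugeTransf (F.P K) 0 (Matrix.specialUnitaryGroup (Fin 2) ℂ) | ∀ U : GaugeField (F.P K) 0 (Matrix.specialUnitaryGroup (Fin 2) ℂ),
      descendTo F ℰp J K hJK (GaugeField.gaugeAct w U) = descendTo F ℰp J K hJK U} := ⟨⟨fun _ => 1, residual_one F hJK⟩⟩
  have hr' := residual_inv F hJK hr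
  apply le_antisymm
  · refine le_ciInf fun w => ?_
    have hrw := residual_mul F hJK hr w.2
    refine (iInf_orbitDistSq_le_of_residual F hJK (GaugeField.gaugeAct r U) U₀ hrw).trans (le_of_eq ?_)
    rw [sum_dist1_sq_gaugeAct_left, ← mul_assoc, inv_mul_cancel, one_mul]
  · refine le_ciInf fun w => ?_
    have hrw := residual_mul F hJK hr' w.2
    refine (iInf_orbitDistSq_le_of_residual F hJK U U₀ hrw).trans (le_of_eq ?_)
    rw [sum_dist1_sq_gaugeAct_left]

/-! ## §3 The body door -/

/-- ★★ **REBASE-U**: for residual `r`, the GAP♯∘ body (✓p838507's conclusion tail VERBATIM) at `r•U` ⟺ at `U`, datum `V` and minimiser `U₀` FIXED.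
Companions for the binders (on the tree, by name): ✓`gaugeAct_mem_fibre_iff_of_residual`, ✓`gaugeAct_mem_histGood_iff`.
[cite: Balaban1985Variational, (1) p.278, Thm 1 (8)-(10) p.279; Balaban1987RG1, p.256] -/
theorem body_gaugeAct_residual_iff {r : Site (F.P K) 0 → Matrix.specialUnitaryGroup (Fin 2) ℂ}
    (hr : ∀ U : GaugeField (F.P K) 0 (Matrix.specialUnitaryGroup (Fin 2) ℂ),
      descendTo F ℰp J K hJK (GaugeField.gaugeAct r U) = descendTo F ℰp J K hJK U)
    (μ ε₀ : ℝ) (V : GaugeField (F.P J) 0 (Matrix.specialUnitaryGroup (Fin 2) ℂ)) (U₀ U : GaugeField (F.P K) 0 (Matrix.specialUnitaryGroup (Fin 2) ℂ)) :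
    (μ * ((F.L : ℝ)⁻¹) ^ (2 * (K - J)) *
          (⨅ w : {w : GaugeTransf (F.P K) 0 (Matrix.specialUnitaryGroup (Fin 2) ℂ) | ∀ U : GaugeField (F.P K) 0 (Matrix.specialUnitaryGroup (Fin 2) ℂ),
              descendTo F ℰp J K hJK (GaugeField.gaugeAct w U) = descendTo F ℰp J K hJK U}, ∑ ℓ : PBond (F.P K) 0,
            dist1 ((GaugeField.gaugeAct r U) ℓ * ((GaugeField.gaugeAct (w : GaugeTransf (F.P K) 0 (Matrix.specialUnitaryGroup (Fin 2) ℂ)) U₀) ℓ)⁻¹) ^ 2)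
        ≤ wilsonAction4 (GaugeField.gaugeAct r U) - minActionRegPr F J K hJK ε₀ V) ↔
      (μ * ((F.L : ℝ)⁻¹) ^ (2 * (K - J)) *
          (⨅ w : {w : GaugeTransf (F.P K) 0 (Matrix.specialUnitaryGroup (Fin 2) ℂ) | ∀ U : GaugeField (F.P K) 0 (Matrix.specialUnitaryGroup (Fin 2) ℂ),
              descendTo F ℰp J K hJK (GaugeField.gaugeAct w U) = descendTo F ℰp J K hJK U}, ∑ ℓ : PBond (F.P K) 0,
            dist1 (U ℓ * ((GaugeField.gaugeAct (w : GaugeTransf (F.P K) 0 (Matrix.specialUnitaryGroup (Fin 2) ℂ)) U₀) ℓ)⁻¹) ^ 2)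
        ≤ wilsonAction4 U - minActionRegPr F J K hJK ε₀ V) := by
  rw [iInf_orbitDistSq_gaugeAct_residual F hJK hr, wilsonAction4_gaugeAct]

/-- USE FORM: the body at `U` from the body at the re-gauged field `r•U` (residual `r`). [cite: Balaban1985Variational, Thm 1 (8)-(10) p.279] -/
theorem body_of_body_gaugeAct_residual {r : Site (F.P K) 0 → Matrix.specialUnitaryGroup (Fin 2) ℂ}
    (hr : ∀ U : GaugeField (F.P K) 0 (Matrix.specialUnitaryGroup (Fin 2) ℂ),
      descendTo F ℰp J K hJK (GaugeField.gaugeAct r U) = descendTo F ℰp J K hJK U)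
    {μ ε₀ : ℝ} {V : GaugeField (F.P J) 0 (Matrix.specialUnitaryGroup (Fin 2) ℂ)} {U₀ U : GaugeField (F.P K) 0 (Matrix.specialUnitaryGroup (Fin 2) ℂ)}
    (h : μ * ((F.L : ℝ)⁻¹) ^ (2 * (K - J)) *
          (⨅ w : {w : GaugeTransf (F.P K) 0 (Matrix.specialUnitaryGroup (Fin 2) ℂ) | ∀ U : GaugeField (F.P K) 0 (Matrix.specialUnitaryGroup (Fin 2) ℂ),
              descendTo F ℰp J K hJK (GaugeField.gaugeAct w U) = descendTo F ℰp J K hJK U}, ∑ ℓ : PBond (F.P K) 0,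
            dist1 ((GaugeField.gaugeAct r U) ℓ * ((GaugeField.gaugeAct (w : GaugeTransf (F.P K) 0 (Matrix.specialUnitaryGroup (Fin 2) ℂ)) U₀) ℓ)⁻¹) ^ 2)
        ≤ wilsonAction4 (GaugeField.gaugeAct r U) - minActionRegPr F J K hJK ε₀ V) :
    μ * ((F.L : ℝ)⁻¹) ^ (2 * (K - J)) *
          (⨅ w : {w : GaugeTransf (F.P K) 0 (Matrix.specialUnitaryGroup (Fin 2) ℂ) | ∀ U : GaugeField (F.P K) 0 (Matrix.specialUnitaryGroup (Fin 2) ℂ),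
              descendTo F ℰp J K hJK (GaugeField.gaugeAct w U) = descendTo F ℰp J K hJK U}, ∑ ℓ : PBond (F.P K) 0,
            dist1 (U ℓ * ((GaugeField.gaugeAct (w : GaugeTransf (F.P K) 0 (Matrix.specialUnitaryGroup (Fin 2) ℂ)) U₀) ℓ)⁻¹) ^ 2)
        ≤ wilsonAction4 U - minActionRegPr F J K hJK ε₀ V :=
  (body_gaugeAct_residual_iff F hJK hr μ ε₀ V U₀ U).mp h

/-! ## §4 The binder-level door: re-basing the whole `∀ U ∈ fibre, U ∈ histGood →` block by a field-dependent residual gauge -/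

/-- ★ **RE-BASING THE QUANTIFIER BLOCK**: if for every admissible `U` some RESIDUAL `r U` re-gauges it to a field at which the body holds, the body holds at
every admissible `U` — the admissibility of `r U • U` (same fibre, same `histGood` class) is supplied to the hypothesis by ✓`gaugeAct_mem_fibre_iff_of_residual`
and ✓`gaugeAct_mem_histGood_iff`. [cite: Balaban1985Variational, (4) p.278, Thm 1 (8)-(10) p.279] -/
theorem body_forall_of_rebase {θ : ℕ → ℝ} {μ ε₀ : ℝ} {V : GaugeField (F.P J) 0 (Matrix.specialUnitaryGroup (Fin 2) ℂ)}
    {U₀ : GaugeField (F.P K) 0 (Matrix.specialUnitaryGroup (Fin 2) ℂ)}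
    (r : GaugeField (F.P K) 0 (Matrix.specialUnitaryGroup (Fin 2) ℂ) → (Site (F.P K) 0 → Matrix.specialUnitaryGroup (Fin 2) ℂ))
    (hr : ∀ U, ∀ X : GaugeField (F.P K) 0 (Matrix.specialUnitaryGroup (Fin 2) ℂ),
      descendTo F ℰp J K hJK (GaugeField.gaugeAct (r U) X) = descendTo F ℰp J K hJK X)
    (h : ∀ U ∈ fibre F ℰp J K hJK V, U ∈ histGood F ℰp θ K J →
      GaugeField.gaugeAct (r U) U ∈ fibre F ℰp J K hJK V → GaugeField.gaugeAct (r U) U ∈ histGood F ℰp θ K J →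
        μ * ((F.L : ℝ)⁻¹) ^ (2 * (K - J)) *
            (⨅ w : {w : GaugeTransf (F.P K) 0 (Matrix.specialUnitaryGroup (Fin 2) ℂ) | ∀ U : GaugeField (F.P K) 0 (Matrix.specialUnitaryGroup (Fin 2) ℂ),
                descendTo F ℰp J K hJK (GaugeField.gaugeAct w U) = descendTo F ℰp J K hJK U}, ∑ ℓ : PBond (F.P K) 0,
              dist1 ((GaugeField.gaugeAct (r U) U) ℓ * ((GaugeField.gaugeAct (w : GaugeTransf (F.P K) 0 (Matrix.specialUnitaryGroup (Fin 2) ℂ)) U₀) ℓ)⁻¹) ^ 2)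
          ≤ wilsonAction4 (GaugeField.gaugeAct (r U) U) - minActionRegPr F J K hJK ε₀ V) :
    ∀ U ∈ fibre F ℰp J K hJK V, U ∈ histGood F ℰp θ K J →
      μ * ((F.L : ℝ)⁻¹) ^ (2 * (K - J)) *
          (⨅ w : {w : GaugeTransf (F.P K) 0 (Matrix.specialUnitaryGroup (Fin 2) ℂ) | ∀ U : GaugeField (F.P K) 0 (Matrix.specialUnitaryGroup (Fin 2) ℂ),
              descendTo F ℰp J K hJK (GaugeField.gaugeAct w U) = descendTo F ℰp J K hJK U}, ∑ ℓ : PBond (F.P K) 0,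
            dist1 (U ℓ * ((GaugeField.gaugeAct (w : GaugeTransf (F.P K) 0 (Matrix.specialUnitaryGroup (Fin 2) ℂ)) U₀) ℓ)⁻¹) ^ 2)
        ≤ wilsonAction4 U - minActionRegPr F J K hJK ε₀ V := by
  intro U hU hUg
  exact body_of_body_gaugeAct_residual F hJK (hr U)
    (h U hU hUg ((gaugeAct_mem_fibre_iff_of_residual F hJK (hr U) U V).mpr hU) ((gaugeAct_mem_histGood_iff F (r U) θ J U).mpr hUg))

end Summit.QuantumFields.YangMills.Theorems.FluctuationComparisonRegPrIntLS2BetaBodyRebaseResidual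

end
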